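import Summits.AnomalousDissipation.AnomalousDissipation.Theorems.SoloBlindMonoscale
import Literature.Analysis.FluidPDE.ZerothLawProofs
import Literature.Analysis.FunctionSpaces.TorusFourierModes
import Literature.Analysis.FunctionSpaces.TorusWeightedGalerkinCoefficients
import HarnessLib

/-!
# Solo (blind) — the laminar dissipation law `β ≤ Λ₀ Re⁻¹` for every 2-D flow under a
# monoscale Doering–Foias force

The Doering–Foias vocabulary of `ZerothLaw` (`ForcingShape`, `ForcingShape.force n F = F Φ(n • ·)`
at scale `ℓ = 1/n`, `doeringFoiasRHS c₁ c₂ ν U ℓ = c₁U³/ℓ + c₂νU²/ℓ²`, `rmsVelocity`,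
`reynoldsNumber U ℓ ν = Uℓ/ν`, `dissipationCoeff ε ℓ U = εℓ/U³`) applied to the monoscale
closure of `SoloBlindMonoscale`. A forcing SHAPE `Φ` on `𝕋²` is *monoscale* when `ΔΦ = -Λ₀Φ`
(`Λ₀ ≥ 0`); then every rescaled force `F Φ(n • ·)` is monoscale with constant `Λ₀ n² = Λ₀/ℓ²`
(`laplacian_force_of_monoscale`, from the tree's `laplacian_force`). Consequences, for every
`ν > 0`, `n ≥ 1`, `F`, smooth `u₀` and every global Leray–Hopf flow `u` on `𝕋²`:

* `meanDissipation_le_of_monoscaleShape`: `ε ≤ Λ₀ n² ν ⟨‖u‖₂²⟩`;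
* `doeringFoias_monoscale_two_dim`: **`ε ≤ doeringFoiasRHS 0 Λ₀ ν U ℓ`** — the Doering–Foias
  bound holds on `𝕋²` under monoscale forcing with **`c₁ = 0`** (no `U³/ℓ` term; the tree's
  `turb.S05`/`turb.S25` statements posit `c₁ > 0`);
* `dissipationCoeff_le_of_monoscaleShape`: for `U > 0`, **`β ≤ Λ₀ · Re⁻¹`** — the LAMINAR
  scaling of the dissipation coefficient is a rigorous upper bound for every such flow, at every
  Reynolds number; in particular `β → 0` along any sequence with `Re → ∞`, which is the negation
  of the zeroth law (`β → β_∞ > 0`) on this leaf;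
* `not_planarZerothLaw_of_monoscaleShape`: the `ZerothLaw` matrix instantiated on `𝕋²` with a
  monoscale shape at any fixed scale and amplitude has no witness.

[cite: DoeringFoias2002, abstract (ε ≤ c₁νU²/ℓ² + c₂U³/ℓ); cite: AlexakisDoering2006PLA, §2
eqs. (16), (21)]
-/

open MeasureTheory Filter Topology Set UnitAddTorus
open scoped ENNReal NNReal

noncomputable section

namespace Summit.AnomalousDissipation.AnomalousDissipation.Theorems

open Literature.Analysis.FunctionSpaces Literature.Analysis.FunctionSpaces.Torus
open Literature.Analysis.FluidPDE

variable {Λ₀ ν : ℝ} {Φ : ForcingShape (Fin 2)} {n : ℕ} {F : ℝ}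
  {u₀ : UnitAddTorus (Fin 2) → EuclideanSpace ℝ (Fin 2)}
  {u : ℝ → UnitAddTorus (Fin 2) → EuclideanSpace ℝ (Fin 2)}

/-- A monoscale shape stays monoscale under the Doering–Foias rescaling, with constant
`Λ₀ n²`: `Δ(F Φ(n • ·)) = -(Λ₀ n²) F Φ(n • ·)`. [folklore] -/
theorem laplacian_force_of_monoscale {d : Type*} [Fintype d] [DecidableEq d]
    (Φ : ForcingShape d) {Λ₀ : ℝ} (hΦ : ∀ x, Torus.laplacian Φ.shape x = -(Λ₀ • Φ.shape x))
    (n : ℕ) (F : ℝ) (x : UnitAddTorus d) :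
    Torus.laplacian (Φ.force n F) x = -((Λ₀ * (n : ℝ) ^ 2) • Φ.force n F x) := by
  rw [laplacian_force, hΦ, ForcingShape.force, smul_neg, smul_smul, smul_smul]
  congr 2
  ring

/-- **`ε ≤ Λ₀ n² ν ⟨‖u‖₂²⟩`** for every global Leray–Hopf flow on `𝕋²` with smooth data under
the rescaled monoscale force `F Φ(n • ·)`. [folklore] -/
theorem meanDissipation_le_of_monoscaleShape (hΛ₀ : 0 ≤ Λ₀)
    (hΦ : ∀ x, Torus.laplacian Φ.shape x = -(Λ₀ • Φ.shape x)) (hν : 0 < ν) (hn : 0 < n)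
    (F : ℝ) (hu₀ : Torus.IsSmooth u₀)
    (hu : Torus.IsGlobalLerayHopf ν (fun _ => Φ.force n F) u₀ u) :
    meanDissipation ν u ≤ Λ₀ * (n : ℝ) ^ 2 * ν * meanEnergy u := by
  obtain ⟨hsm, hdiv, hzm⟩ := ForcingShape.force_regular_holds Φ hn F
  exact meanDissipation_le_of_monoscale hν hsm hdiv hzm (by positivity)
    (laplacian_force_of_monoscale Φ hΦ n F) hu₀ hu

/-- `U² = ⟨‖u‖₂²⟩`: the square of the r.m.s. velocity is the mean energy. [folklore] -/
theorem rmsVelocity_sq_eq_meanEnergy {d : Type*} [Fintype d]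
    (u : ℝ → UnitAddTorus d → EuclideanSpace ℝ d) :
    rmsVelocity longTimeAvgSup u ^ 2 = meanEnergy u := by
  rw [rmsVelocity_eq_sqrt_meanEnergy, Real.sq_sqrt (meanEnergy_nonneg u)]

/-- **Doering–Foias with `c₁ = 0` on `𝕋²` under monoscale forcing**:
`ε ≤ doeringFoiasRHS 0 Λ₀ ν U ℓ = Λ₀ ν U²/ℓ²`, `ℓ = 1/n`, for every global Leray–Hopf flow with
smooth data. [folklore] -/
theorem doeringFoias_monoscale_two_dim (hΛ₀ : 0 ≤ Λ₀)
    (hΦ : ∀ x, Torus.laplacian Φ.shape x = -(Λ₀ • Φ.shape x)) (hν : 0 < ν) (hn : 0 < n)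
    (F : ℝ) (hu₀ : Torus.IsSmooth u₀)
    (hu : Torus.IsGlobalLerayHopf ν (fun _ => Φ.force n F) u₀ u) :
    meanDissipation ν u ≤ doeringFoiasRHS 0 Λ₀ ν (rmsVelocity longTimeAvgSup u) ((n : ℝ)⁻¹) := by
  have h := meanDissipation_le_of_monoscaleShape hΛ₀ hΦ hν hn F hu₀ hu
  have hn' : (n : ℝ) ≠ 0 := by exact_mod_cast hn.ne'
  have e : doeringFoiasRHS 0 Λ₀ ν (rmsVelocity longTimeAvgSup u) ((n : ℝ)⁻¹) =
      Λ₀ * (n : ℝ) ^ 2 * ν * meanEnergy u := by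
    rw [doeringFoiasRHS, ← rmsVelocity_sq_eq_meanEnergy]
    field_simp
    ring
  rwa [e]

/-- **The laminar law `β ≤ Λ₀ Re⁻¹`**: for every global Leray–Hopf flow on `𝕋²` with smooth data
under a monoscale force at scale `ℓ = 1/n` and with `U > 0`, the dissipation coefficient obeys
`εℓ/U³ ≤ Λ₀ (Uℓ/ν)⁻¹`. [folklore] -/
theorem dissipationCoeff_le_of_monoscaleShape (hΛ₀ : 0 ≤ Λ₀)
    (hΦ : ∀ x, Torus.laplacian Φ.shape x = -(Λ₀ • Φ.shape x)) (hν : 0 < ν) (hn : 0 < n)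
    (F : ℝ) (hu₀ : Torus.IsSmooth u₀)
    (hu : Torus.IsGlobalLerayHopf ν (fun _ => Φ.force n F) u₀ u)
    (hU : 0 < rmsVelocity longTimeAvgSup u) :
    dissipationCoeff (meanDissipation ν u) ((n : ℝ)⁻¹) (rmsVelocity longTimeAvgSup u) ≤
      Λ₀ * (reynoldsNumber (rmsVelocity longTimeAvgSup u) ((n : ℝ)⁻¹) ν)⁻¹ := by
  have h := meanDissipation_le_of_monoscaleShape hΛ₀ hΦ hν hn F hu₀ hu
  rw [← rmsVelocity_sq_eq_meanEnergy] at h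
  set U := rmsVelocity longTimeAvgSup u with hUdef
  have hn' : (0 : ℝ) < n := by exact_mod_cast hn
  rw [dissipationCoeff, reynoldsNumber]
  rw [div_le_iff₀ (by positivity)]
  calc meanDissipation ν u * (n : ℝ)⁻¹ ≤ Λ₀ * (n : ℝ) ^ 2 * ν * U ^ 2 * (n : ℝ)⁻¹ :=
        mul_le_mul_of_nonneg_right h (by positivity)
    _ = Λ₀ * (U * (n : ℝ)⁻¹ / ν)⁻¹ * U ^ 3 := by
        field_simp

/-- **No planar zeroth law under a monoscale Doering–Foias force** (fixed shape, scale and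
amplitude; smooth data): along `ν_j → 0` with `meanEnergy ≤ E` the dissipation is `≤ Λ₀n²Eν_j`,
so no floor `ε > 0` survives. [folklore] -/
theorem not_planarZerothLaw_of_monoscaleShape (hΛ₀ : 0 ≤ Λ₀)
    (hΦ : ∀ x, Torus.laplacian Φ.shape x = -(Λ₀ • Φ.shape x)) (hn : 0 < n) (F : ℝ) :
    ¬ ∃ (νs : ℕ → ℝ) (u₀s : ℕ → UnitAddTorus (Fin 2) → EuclideanSpace ℝ (Fin 2))
        (us : ℕ → ℝ → UnitAddTorus (Fin 2) → EuclideanSpace ℝ (Fin 2)),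
        (∀ j, 0 < νs j) ∧ Tendsto νs atTop (𝓝 0) ∧ (∀ j, Torus.IsSmooth (u₀s j)) ∧
          (∀ j, Torus.IsGlobalLerayHopf (νs j) (fun _ => Φ.force n F) (u₀s j) (us j)) ∧
          (∃ E : ℝ, ∀ j, meanEnergy (us j) ≤ E) ∧
          ∃ ε : ℝ, 0 < ε ∧ ∀ j, ε ≤ meanDissipation (νs j) (us j) := by
  obtain ⟨hsm, hdiv, hzm⟩ := ForcingShape.force_regular_holds Φ hn F
  exact not_planarZerothLaw_of_monoscale hsm hdiv hzm (by positivity : 0 ≤ Λ₀ * (n : ℝ) ^ 2)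
    (laplacian_force_of_monoscale Φ hΦ n F)

/-! ### A monoscale shape exists: the normalised Kolmogorov shape `√2 cos(2π x₂) e₁` on `𝕋²` -/

/-- The Kolmogorov frequency `e₂ = (0, 1)`. [folklore] -/
def kol2Freq : Fin 2 → ℤ := ![0, 1]

/-- The modes `{e₂, -e₂}` of the planar Kolmogorov shape. [folklore] -/
def kol2Modes : Finset (Fin 2 → ℤ) := {kol2Freq, -kol2Freq}

/-- Membership in `{e₂, -e₂}`. [folklore] -/
theorem mem_kol2Modes_iff {k : Fin 2 → ℤ} : k ∈ kol2Modes ↔ k = kol2Freq ∨ k = -kol2Freq := by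
  simp [kol2Modes]

/-- On the Kolmogorov modes the first frequency component vanishes. [folklore] -/
theorem apply_zero_of_mem_kol2Modes {k : Fin 2 → ℤ} (hk : k ∈ kol2Modes) : k 0 = 0 := by
  rcases mem_kol2Modes_iff.1 hk with rfl | rfl <;> simp [kol2Freq]

/-- The Kolmogorov modes are non-zero. [folklore] -/
theorem ne_zero_of_mem_kol2Modes {k : Fin 2 → ℤ} (hk : k ∈ kol2Modes) : k ≠ 0 := by
  rcases mem_kol2Modes_iff.1 hk with rfl | rfl <;>
    exact fun h => by simpa [kol2Freq] using congrFun h 1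

/-- `{e₂, -e₂}` is symmetric. [folklore] -/
theorem kol2Modes_symm : ∀ k ∈ kol2Modes, -k ∈ kol2Modes := by
  intro k hk
  rcases mem_kol2Modes_iff.1 hk with rfl | rfl <;> simp [kol2Modes]

/-- `|k|² = 1` on the Kolmogorov modes. [folklore] -/
theorem freqNormSq_of_mem_kol2Modes {k : Fin 2 → ℤ} (hk : k ∈ kol2Modes) : freqNormSq k = 1 := by
  rcases mem_kol2Modes_iff.1 hk with rfl | rfl <;> simp [freqNormSq, Fin.sum_univ_two, kol2Freq]

/-- Sums over `{e₂, -e₂}`. [folklore] -/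
theorem sum_kol2Modes {M : Type*} [AddCommMonoid M] (g : (Fin 2 → ℤ) → M) :
    ∑ k ∈ kol2Modes, g k = g kol2Freq + g (-kol2Freq) :=
  Finset.sum_pair fun h => by simpa [kol2Freq] using congrFun h 1

/-- The polarisation vector `(√2/2) e₁`, complexified. [folklore] -/
def kol2Vec : EuclideanSpace ℂ (Fin 2) :=
  EuclideanSpace.complexify
    (EuclideanSpace.single 0 (Real.sqrt 2 / 2 : ℝ) : EuclideanSpace ℝ (Fin 2))

/-- Second component of the polarisation vector vanishes. [folklore] -/
@[simp] theorem kol2Vec_apply_one : kol2Vec 1 = 0 := by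
  simp [kol2Vec, EuclideanSpace.complexify_apply]

/-- `‖(√2/2) e₁‖² = ½`. [folklore] -/
theorem norm_sq_kol2Vec : ‖kol2Vec‖ ^ 2 = 1 / 2 := by
  rw [kol2Vec, EuclideanSpace.norm_complexify, PiLp.norm_single, Real.norm_eq_abs,
    sq_abs, div_pow, Real.sq_sqrt (by norm_num : (0 : ℝ) ≤ 2)]
  norm_num

/-- Coefficients of the Kolmogorov shape: `(√2/2) e₁` off the zero mode. [folklore] -/
def kol2Coeff (k : Fin 2 → ℤ) : EuclideanSpace ℂ (Fin 2) := if k = 0 then 0 else kol2Vec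

/-- Off the zero mode the coefficient is the polarisation vector. [folklore] -/
theorem kol2Coeff_of_ne_zero {k : Fin 2 → ℤ} (hk : k ≠ 0) : kol2Coeff k = kol2Vec := if_neg hk

/-- The coefficients are conjugate symmetric (the shape is real). [folklore] -/
theorem isConjSymm_kol2Coeff : IsConjSymm kol2Coeff := by
  intro k
  by_cases hk : k = 0
  · subst hk
    simp [kol2Coeff, EuclideanSpace.conjVec_zero]
  · rw [kol2Coeff_of_ne_zero (neg_ne_zero.2 hk), kol2Coeff_of_ne_zero hk, kol2Vec,
      EuclideanSpace.conjVec_complexify]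

/-- The coefficients are transversal (`k · ĉ(k) = 0`). [folklore] -/
theorem isTransversal_kol2Coeff : IsTransversal kol2Modes kol2Coeff := by
  intro k hk
  rw [kol2Coeff_of_ne_zero (ne_zero_of_mem_kol2Modes hk), Fin.sum_univ_two,
    apply_zero_of_mem_kol2Modes hk, kol2Vec_apply_one]
  simp

/-- **The planar Kolmogorov shape** `Φ(x) = √2 cos(2π x₂) e₁` as a real trigonometric polynomial
on `{e₂, -e₂}`. [folklore] -/
def kol2Fun : UnitAddTorus (Fin 2) → EuclideanSpace ℝ (Fin 2) := realTrigPoly kol2Modes kol2Coeff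

/-- The Kolmogorov shape has zero mean (no zero mode). [folklore] -/
theorem hasZeroMean_kol2Fun : Torus.HasZeroMean kol2Fun := by
  show ∫ x, EuclideanSpace.realPart (trigPoly kol2Modes kol2Coeff x) = 0
  have hI : Integrable (trigPoly kol2Modes kol2Coeff) volume :=
    (continuous_trigPoly _ _).integrable_unitAddTorus
  rw [(EuclideanSpace.realPart :
    EuclideanSpace ℂ (Fin 2) →L[ℝ] EuclideanSpace ℝ (Fin 2)).integral_comp_comm hI]
  have h : ∫ x, trigPoly kol2Modes kol2Coeff x = 0 := by
    simp_rw [trigPoly_apply]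
    have hint : ∀ k ∈ kol2Modes,
        Integrable (fun x : UnitAddTorus (Fin 2) => mFourier k x • kol2Coeff k) volume :=
      fun k _ => ((mFourier k).continuous.smul continuous_const).integrable_unitAddTorus
    rw [integral_finsetSum _ hint]
    refine Finset.sum_eq_zero fun k hk => ?_
    rw [integral_smul_const, integral_mFourier, if_neg (ne_zero_of_mem_kol2Modes hk), zero_smul]
  rw [h, map_zero]

/-- `‖Φ‖₂² = 1`. [folklore] -/
theorem integral_norm_sq_kol2Fun : ∫ x, ‖kol2Fun x‖ ^ 2 = 1 := by
  rw [kol2Fun, integral_norm_sq_realTrigPoly kol2Modes_symm isConjSymm_kol2Coeff, sum_kol2Modes,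
    kol2Coeff_of_ne_zero (ne_zero_of_mem_kol2Modes (by simp [kol2Modes])),
    kol2Coeff_of_ne_zero (ne_zero_of_mem_kol2Modes (by simp [kol2Modes])), norm_sq_kol2Vec]
  norm_num

/-- **The planar Kolmogorov forcing shape** (Doering–Foias normalisation `‖Φ‖₂ = 1`):
`Φ = √2 cos(2π x₂) e₁`, smooth, divergence free, mean zero. [folklore] -/
def kolShape₂ : ForcingShape (Fin 2) where
  shape := kol2Fun
  smooth := isSmooth_realTrigPoly _ _
  divFree := isDivFree_realTrigPoly isTransversal_kol2Coeff
  zeroMean := hasZeroMean_kol2Fun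
  sq_norm_eq_one := integral_norm_sq_kol2Fun

/-- The planar Kolmogorov shape is monoscale: `ΔΦ = -4π² Φ`. [folklore] -/
theorem laplacian_kolShape₂ (x : UnitAddTorus (Fin 2)) :
    Torus.laplacian kolShape₂.shape x = -((4 * Real.pi ^ 2) • kolShape₂.shape x) := by
  show Torus.laplacian (realTrigPoly kol2Modes kol2Coeff) x =
    -((4 * Real.pi ^ 2) • realTrigPoly kol2Modes kol2Coeff x)
  rw [laplacian_realTrigPoly, ← neg_smul, ← Pi.smul_apply (-(4 * Real.pi ^ 2)) (realTrigPoly _ _),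
    ← realTrigPoly_smul]
  exact congrFun (realTrigPoly_congr fun k hk => by
    rw [freqNormSq_of_mem_kol2Modes hk, Pi.smul_apply, ← Complex.coe_smul, ← neg_smul]
    congr 1
    push_cast
    ring) x

/-- **The planar Kolmogorov leaf of the zeroth law is closed**: for the force
`F √2 cos(2πn x₂) e₁` on `𝕋²` (any scale `n ≥ 1`, any amplitude `F`), every global Leray–Hopf
flow with smooth data has `β ≤ 4π² Re⁻¹` and no bounded-energy vanishing-viscosity family has
a dissipation floor. [folklore] -/
theorem not_planarZerothLaw_kolmogorov₂ (hn : 0 < n) (F : ℝ) :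
    ¬ ∃ (νs : ℕ → ℝ) (u₀s : ℕ → UnitAddTorus (Fin 2) → EuclideanSpace ℝ (Fin 2))
        (us : ℕ → ℝ → UnitAddTorus (Fin 2) → EuclideanSpace ℝ (Fin 2)),
        (∀ j, 0 < νs j) ∧ Tendsto νs atTop (𝓝 0) ∧ (∀ j, Torus.IsSmooth (u₀s j)) ∧
          (∀ j, Torus.IsGlobalLerayHopf (νs j) (fun _ => kolShape₂.force n F) (u₀s j) (us j)) ∧
          (∃ E : ℝ, ∀ j, meanEnergy (us j) ≤ E) ∧
          ∃ ε : ℝ, 0 < ε ∧ ∀ j, ε ≤ meanDissipation (νs j) (us j) :=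
  not_planarZerothLaw_of_monoscaleShape (by positivity) laplacian_kolShape₂ hn F

/-- The laminar law for planar Kolmogorov flow at every Reynolds number:
`β ≤ 4π² Re⁻¹` (`U > 0`, smooth data, any Leray–Hopf flow). [folklore] -/
theorem dissipationCoeff_le_kolmogorov₂ (hν : 0 < ν) (hn : 0 < n) (F : ℝ)
    (hu₀ : Torus.IsSmooth u₀)
    (hu : Torus.IsGlobalLerayHopf ν (fun _ => kolShape₂.force n F) u₀ u)
    (hU : 0 < rmsVelocity longTimeAvgSup u) :
    dissipationCoeff (meanDissipation ν u) ((n : ℝ)⁻¹) (rmsVelocity longTimeAvgSup u) ≤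
      4 * Real.pi ^ 2 * (reynoldsNumber (rmsVelocity longTimeAvgSup u) ((n : ℝ)⁻¹) ν)⁻¹ :=
  dissipationCoeff_le_of_monoscaleShape (by positivity) laplacian_kolShape₂ hν hn F hu₀ hu hU

end Summit.AnomalousDissipation.AnomalousDissipation.Theorems
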